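import Summits.CriticalPhenomena.PercolationContinuityZ3.Theses.PercTorusSliceFilling
import Literature.Probability.Percolation.DisjointOccurrencePow
import Summits.CriticalPhenomena.PercolationContinuityZ3.Theorems.PercTorusSliceFillingTorusNonProliferationBK
import Summits.CriticalPhenomena.PercolationContinuityZ3.Theorems.PercTorusSliceFillingNoCriticalTorusGiantClusterExploration
import Summits.CriticalPhenomena.PercolationContinuityZ3.Theorems.PercTorusSliceFillingNoCriticalTorusGiantParentSplit
import HarnessLib

/-!
# Route `PercTorusSliceFilling`, crux `NoCriticalTorusGiant` — universal tightness of the largest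
# critical torus cluster (support file, item stmt-CriticalPhenomena-5407)

The sprinkling-free part of line `registered` as reshaped by lead c3 (2026-08-17), kernel-checked and
moved from the crux skeleton (`Cruxes/NoCriticalTorusGiant/Lines/birth.lean` §2.2–§2.3) into the tree:

* `real_exists_three_mul_le_sq` — **the doubling inequality** (T. Hutchcroft, *Power-law bounds for
  critical long-range percolation below the upper-critical dimension*, PTRF 181 (2021),
  arXiv:2008.11197, Thm 2.3 with `k = 1`, torus form): for every edge density `p`, every `n ≥ 1` and
  `k ≥ 1`, `P_{T_n,p}(∃ x, |C(x)| ≥ 3k) ≤ P_{T_n,p}(∃ x, |C(x)| ≥ k)²`.  The exploration enumeration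
  of a `3k`-cluster (`stub_clusterExploration`, landed) carries a parent function which
  `stub_parentSplit` (landed) splits into two rooted `π`-closed index sets `A ∋ a`, `B ∋ b` of size
  `≥ k` with `A ∖ {a}`, `B ∖ {b}` disjoint; the parent edges of `A ∖ {a}` and of `B ∖ {b}` are two
  DISJOINT open witnesses of the increasing event `{∃ x, |C(x)| ≥ k}` (`UT.card_le_ncard_openCluster_root`),
  so the van den Berg–Kesten inequality (`measureReal_disjointOccurrencePow_le`) applies.
* `real_exists_pow_mul_le_pow` — iterated: `P(∃ x, |C(x)| ≥ 3^j k) ≤ P(∃ x, |C(x)| ≥ k)^(2^j)`.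
* `noCriticalTorusGiant_of_noGiantWithPositiveProbability`, `…_iff_…` — **the transfer**: the crux
  `NoCriticalTorusGiant` (no `ε`-giant on the critical 3-torus w.h.p.) is EQUIVALENT to the formally
  weaker "there is `ρ > 0` such that for every `a > 0`, eventually `P_{T_n,p_c}(∃ x, |C(x)| ≥ a n³) ≤ 1 - ρ`"
  (Easo–Hutchcroft 2024 §5: the "weaker supercritical existence property"; qualitative universal
  tightness).  This is the registered residual stub R of the line; it is exactly as open as the crux
  (Easo–Hutchcroft, Duke Math. J. 173 (2024), Rem. 1.4).

No named facts are assumed; no new definitions (events are written out).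
-/

noncomputable section

namespace Summit.CriticalPhenomena.PercolationContinuityZ3.Theorems.PercTorusSliceFillingNoCriticalTorusGiant

open MeasureTheory Filter Topology
open Literature.Probability.Percolation Literature.Probability.LatticeModels

namespace UT

/-- The event `E_k = {∃ x, k ≤ |C(x)|}` ("some open cluster has at least `k` vertices") on the
finite torus is increasing. [folklore] -/
theorem isUpperSet_existsLargeCluster (n k : ℕ) [NeZero n] :
    IsUpperSet {ω : BondConfig (TorusSite 3 n) | ∃ x : TorusSite 3 n, k ≤ (openCluster ω x).ncard} := by
  rintro ω ω' hle ⟨x, hx⟩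
  refine ⟨x, hx.trans (Set.ncard_le_ncard (fun y hy => ?_) (Set.toFinite _))⟩
  exact SimpleGraph.Reachable.mono (openGraph_mono hle) hy

/-- Along a `π`-closed rooted index set the exploration edges join every vertex to the root:
if `A ∋ a` lies above `a`, is closed under `π` away from `a`, and `W` contains the edges
`s(v (π i), v i)`, `i ∈ A ∖ {a}`, with `v` injective on the relevant indices and `π i < i`, then
`v a ↔ v i` in `openGraph W` for every `i ∈ A`. [folklore] -/
theorem reachable_root_of_closed {V : Type*} (v : ℕ → V) (π : ℕ → ℕ) (m : ℕ)
    (hv : Set.InjOn v (Set.Iio m)) (hπ : ∀ i, 0 < i → i < m → π i < i)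
    (A : Finset ℕ) (a : ℕ) (hAm : ∀ i ∈ A, i < m) (hAa : ∀ i ∈ A, a ≤ i)
    (hAπ : ∀ i ∈ A, i ≠ a → π i ∈ A) (W : BondConfig V)
    (hW : ∀ i ∈ A, i ≠ a → s(v (π i), v i) ∈ W) :
    ∀ i ∈ A, (openGraph W).Reachable (v a) (v i) := by
  intro i
  induction i using Nat.strong_induction_on with
  | _ i ih =>
    intro hi
    by_cases hia : i = a
    · subst hia; exact SimpleGraph.Reachable.refl _
    · have hai : a < i := lt_of_le_of_ne (hAa i hi) (Ne.symm hia)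
      have hi0 : 0 < i := lt_of_le_of_lt (Nat.zero_le a) hai
      have him : i < m := hAm i hi
      have hπi : π i < i := hπ i hi0 him
      have hπA : π i ∈ A := hAπ i hi hia
      have hreach : (openGraph W).Reachable (v a) (v (π i)) := ih (π i) hπi hπA
      have hne : v (π i) ≠ v i := by
        intro h
        have := hv (show π i ∈ Set.Iio m from lt_trans hπi him) (show i ∈ Set.Iio m from him) h
        omega
      have hadj : (openGraph W).Adj (v (π i)) (v i) := by
        rw [openGraph_adj]
        exact ⟨hW i hi hia, hne⟩
      exact hreach.trans hadj.reachable

/-- The image of a rooted `π`-closed index set lies in the open cluster of the root's image in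
the witness configuration, hence that cluster has at least `|A|` vertices. [folklore] -/
theorem card_le_ncard_openCluster_root {V : Type*} [Finite V] (v : ℕ → V) (π : ℕ → ℕ) (m : ℕ)
    (hv : Set.InjOn v (Set.Iio m)) (hπ : ∀ i, 0 < i → i < m → π i < i)
    (A : Finset ℕ) (a : ℕ) (hAm : ∀ i ∈ A, i < m) (hAa : ∀ i ∈ A, a ≤ i)
    (hAπ : ∀ i ∈ A, i ≠ a → π i ∈ A) (W : BondConfig V)
    (hW : ∀ i ∈ A, i ≠ a → s(v (π i), v i) ∈ W) :
    A.card ≤ (openCluster W (v a)).ncard := by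
  classical
  have himg : (↑(A.image v) : Set V) ⊆ openCluster W (v a) := by
    intro y hy
    rw [Finset.coe_image] at hy
    obtain ⟨i, hi, rfl⟩ := hy
    exact reachable_root_of_closed v π m hv hπ A a hAm hAa hAπ W hW i hi
  have hinj : Set.InjOn v (A : Set ℕ) := fun i hi j hj h =>
    hv (show i ∈ Set.Iio m from hAm i hi) (show j ∈ Set.Iio m from hAm j hj) h
  calc A.card = (A.image v).card := (Finset.card_image_of_injOn hinj).symm
    _ = (↑(A.image v) : Set V).ncard := (Set.ncard_coe_finset _).symm
    _ ≤ (openCluster W (v a)).ncard := Set.ncard_le_ncard himg (Set.toFinite _)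

end UT

open UT

/-- **The sprinkling-free doubling inequality** (Hutchcroft 2021, Thm 2.3, `k = 1`, torus
form), from U1a + U1b: for every `p`, `n ≥ 1`, `k ≥ 1`,
`P_{T_n,p}(∃ x, |C(x)| ≥ 3k) ≤ P_{T_n,p}(∃ x, |C(x)| ≥ k)²`.  The exploration of a `3k`-cluster
(U1a) carries a parent function; U1b splits its indices into `A ∋ a`, `B ∋ b`; the parent edges
of `A ∖ {a}` and of `B ∖ {b}` are disjoint open witnesses of `{∃ x, |C(x)| ≥ k}`
(`card_le_ncard_openCluster_root`), so the event lies in the twofold disjoint occurrence and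
the van den Berg–Kesten inequality (`measureReal_disjointOccurrencePow_le`) applies. [folklore] -/
theorem real_exists_three_mul_le_sq (p : unitInterval) (n k : ℕ) [NeZero n] (hk : 1 ≤ k) :
    (bondPercolation (torusGraph 3 n) p).real
        {ω | ∃ x : TorusSite 3 n, 3 * k ≤ (openCluster ω x).ncard} ≤
      ((bondPercolation (torusGraph 3 n) p).real
        {ω | ∃ x : TorusSite 3 n, k ≤ (openCluster ω x).ncard}) ^ 2 := by
  classical
  set E : Set (BondConfig (TorusSite 3 n)) :=
    {ω | ∃ x : TorusSite 3 n, k ≤ (openCluster ω x).ncard} with hE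
  have hEup : IsUpperSet E := isUpperSet_existsLargeCluster n k
  -- `{∃ x, 3k ≤ |C(x)|} ⊆ E □ E`
  have hsub : {ω : BondConfig (TorusSite 3 n) |
      ∃ x : TorusSite 3 n, 3 * k ≤ (openCluster ω x).ncard} ⊆ disjointOccurrencePow E 2 := by
    rintro ω ⟨x, hx⟩
    obtain ⟨v, hv, -, hpar⟩ := stub_clusterExploration n ω x (3 * k) hx
    -- the parent function of the exploration
    have hπex : ∀ i, ∃ j, (0 < i → i < 3 * k → j < i ∧ s(v j, v i) ∈ ω) := by
      intro i
      by_cases h : 0 < i ∧ i < 3 * k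
      · obtain ⟨j, hj, hjω⟩ := hpar i h.1 h.2
        exact ⟨j, fun _ _ => ⟨hj, hjω⟩⟩
      · exact ⟨0, fun h1 h2 => (h ⟨h1, h2⟩).elim⟩
    choose π hπ using hπex
    have hπlt : ∀ i, 0 < i → i < 3 * k → π i < i := fun i h1 h2 => (hπ i h1 h2).1
    have hπω : ∀ i, 0 < i → i < 3 * k → s(v (π i), v i) ∈ ω := fun i h1 h2 => (hπ i h1 h2).2
    obtain ⟨A, B, a, b, haA, hbB, hAk, hBk, hAm, hBm, hAa, hBb, hAπ, hBπ, hdisj⟩ :=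
      stub_parentSplit (3 * k) k π hk le_rfl hπlt
    -- the two witnesses
    set WA : BondConfig (TorusSite 3 n) := (fun i => s(v (π i), v i)) '' ↑(A.erase a) with hWA
    set WB : BondConfig (TorusSite 3 n) := (fun i => s(v (π i), v i)) '' ↑(B.erase b) with hWB
    have hposA : ∀ i ∈ A, i ≠ a → 0 < i ∧ i < 3 * k := fun i hi hia =>
      ⟨lt_of_le_of_lt (Nat.zero_le a) (lt_of_le_of_ne (hAa i hi) (Ne.symm hia)), hAm i hi⟩
    have hposB : ∀ i ∈ B, i ≠ b → 0 < i ∧ i < 3 * k := fun i hi hib =>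
      ⟨lt_of_le_of_lt (Nat.zero_le b) (lt_of_le_of_ne (hBb i hi) (Ne.symm hib)), hBm i hi⟩
    have hWAω : WA ⊆ ω := by
      rintro e ⟨i, hi, rfl⟩
      rw [Finset.mem_coe, Finset.mem_erase] at hi
      exact hπω i (hposA i hi.2 hi.1).1 (hposA i hi.2 hi.1).2
    have hWBω : WB ⊆ ω := by
      rintro e ⟨i, hi, rfl⟩
      rw [Finset.mem_coe, Finset.mem_erase] at hi
      exact hπω i (hposB i hi.2 hi.1).1 (hposB i hi.2 hi.1).2
    have hWAE : WA ∈ E := by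
      refine ⟨v a, hAk.trans ?_⟩
      refine card_le_ncard_openCluster_root v π (3 * k) hv hπlt A a hAm hAa hAπ WA ?_
      intro i hi hia
      exact ⟨i, by rw [Finset.mem_coe, Finset.mem_erase]; exact ⟨hia, hi⟩, rfl⟩
    have hWBE : WB ∈ E := by
      refine ⟨v b, hBk.trans ?_⟩
      refine card_le_ncard_openCluster_root v π (3 * k) hv hπlt B b hBm hBb hBπ WB ?_
      intro i hi hib
      exact ⟨i, by rw [Finset.mem_coe, Finset.mem_erase]; exact ⟨hib, hi⟩, rfl⟩
    have hWdisj : Disjoint WA WB := by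
      refine Set.disjoint_left.2 ?_
      rintro e ⟨i, hi, rfl⟩ ⟨i', hi', heq⟩
      rw [Finset.mem_coe] at hi hi'
      have hiA := Finset.mem_erase.1 hi
      have hiB := Finset.mem_erase.1 hi'
      have hi3 := hposA i hiA.2 hiA.1
      have hi3' := hposB i' hiB.2 hiB.1
      have hπi := hπlt i hi3.1 hi3.2
      have hπi' := hπlt i' hi3'.1 hi3'.2
      rcases Sym2.eq_iff.1 heq with ⟨h1, h2⟩ | ⟨h1, h2⟩
      · -- same child index: contradicts disjointness of the erased sets
        have hii' : i' = i :=
          hv (show i' ∈ Set.Iio (3 * k) from hi3'.2) (show i ∈ Set.Iio (3 * k) from hi3.2) h2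
        subst hii'
        exact Finset.disjoint_left.1 hdisj hi hi'
      · -- crossed: `π i' = i` and `i' = π i`, impossible with `π` decreasing
        have h3 : π i' = i :=
          hv (show π i' ∈ Set.Iio (3 * k) from lt_trans hπi' hi3'.2)
            (show i ∈ Set.Iio (3 * k) from hi3.2) h1
        have h4 : i' = π i :=
          hv (show i' ∈ Set.Iio (3 * k) from hi3'.2)
            (show π i ∈ Set.Iio (3 * k) from lt_trans hπi hi3.2) h2
        omega
    -- assemble the twofold disjoint occurrence with the witness family `K = (WA, WB)`
    let K : Fin 2 → BondConfig (TorusSite 3 n) := fun j => if j = 0 then WA else WB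
    have hK0 : K 0 = WA := rfl
    have hK1 : K 1 = WB := rfl
    refine mem_disjointOccurrencePow_of_pairwise_disjoint hEup K ?_ ?_ ?_
    · intro j
      fin_cases j
      · exact hWAω
      · exact hWBω
    · intro j
      fin_cases j
      · exact hWAE
      · exact hWBE
    · intro j j' hjj'
      fin_cases j <;> fin_cases j'
      · exact (hjj' rfl).elim
      · exact hWdisj
      · exact hWdisj.symm
      · exact (hjj' rfl).elim
  calc (bondPercolation (torusGraph 3 n) p).real
        {ω | ∃ x : TorusSite 3 n, 3 * k ≤ (openCluster ω x).ncard}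
      ≤ (bondPercolation (torusGraph 3 n) p).real (disjointOccurrencePow E 2) :=
        measureReal_mono hsub
    _ ≤ ((bondPercolation (torusGraph 3 n) p).real E) ^ 2 :=
        measureReal_disjointOccurrencePow_le (torusGraph 3 n) p
          (Summit.CriticalPhenomena.PercolationContinuityZ3.Theorems.PercTorusSliceFillingTorusNonProliferationBK.isLocalEvent_of_torus
            n E) 2

/-- **Iterated doubling**: `P_{T_n,p}(∃ x, |C(x)| ≥ 3^j k) ≤ P_{T_n,p}(∃ x, |C(x)| ≥ k)^(2^j)`
for `k ≥ 1` (Hutchcroft 2021 Thm 2.3, weakened exponent `2^j ≤ 3^{j-1} + 1`). [folklore] -/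
theorem real_exists_pow_mul_le_pow (p : unitInterval) (n k : ℕ) [NeZero n] (hk : 1 ≤ k) (j : ℕ) :
    (bondPercolation (torusGraph 3 n) p).real
        {ω | ∃ x : TorusSite 3 n, 3 ^ j * k ≤ (openCluster ω x).ncard} ≤
      ((bondPercolation (torusGraph 3 n) p).real
        {ω | ∃ x : TorusSite 3 n, k ≤ (openCluster ω x).ncard}) ^ (2 ^ j) := by
  induction j with
  | zero => simp
  | succ j ih =>
    have hk' : 1 ≤ 3 ^ j * k := Nat.mul_pos (pow_pos (by norm_num) j) hk
    have h1 := real_exists_three_mul_le_sq p n (3 ^ j * k) hk'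
    have heq : (3 : ℕ) ^ (j + 1) * k = 3 * (3 ^ j * k) := by ring
    rw [heq, pow_succ, pow_mul]
    exact h1.trans (pow_le_pow_left₀ measureReal_nonneg ih 2)



/-- The trivial direction: the crux implies "no giant with probability bounded below" (any `ρ < 1`,
here `ρ = 1/2`). [folklore] -/
theorem noGiantWithPositiveProbability_of_noCriticalTorusGiant
    (h : Summit.CriticalPhenomena.PercolationContinuityZ3.Theses.PercTorusSliceFilling.NoCriticalTorusGiant) :
    ∃ ρ : ℝ, 0 < ρ ∧ ∀ a : ℝ, 0 < a → ∀ᶠ n : ℕ in atTop,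
      (bondPercolation (torusGraph 3 n) (criticalProbI 3)).real
          {ω | ∃ x : TorusSite 3 n, a * (n : ℝ) ^ 3 ≤ ((openCluster ω x).ncard : ℝ)} ≤ 1 - ρ := by
  refine ⟨1 / 2, by norm_num, fun a ha => ?_⟩
  have h1 := h a ha
  have h2 : ∀ᶠ n : ℕ in atTop, (bondPercolation (torusGraph 3 n) (criticalProbI 3)).real
      {ω | ∃ x : TorusSite 3 n, a * (n : ℝ) ^ 3 ≤ ((openCluster ω x).ncard : ℝ)} < 1 / 2 :=
    (tendsto_order.1 h1).2 _ (by norm_num)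
  filter_upwards [h2] with n hn
  linarith

/-- **The universal-tightness transfer.**  "No giant with probability bounded below" implies the crux
`PercTorusSliceFilling.NoCriticalTorusGiant`, concluded BY NAME: for `ε, η > 0` choose `j` with
`(1-ρ)₊^{2^j} < η`, put `a = ε / (2·3^j)` and `k_n = ⌈a n³⌉`; for large `n`, `3^j k_n ≤ ε n³`, R gives
`P(∃ x, |C(x)| ≥ a n³) ≤ 1 - ρ`, and the iterated doubling inequality gives
`P(ε-giant) ≤ P(∃ x, |C(x)| ≥ 3^j k_n) ≤ P(∃ x, |C(x)| ≥ k_n)^{2^j} ≤ (1-ρ)₊^{2^j} < η`. [folklore] -/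
theorem noCriticalTorusGiant_of_noGiantWithPositiveProbability
    (hR : ∃ ρ : ℝ, 0 < ρ ∧ ∀ a : ℝ, 0 < a → ∀ᶠ n : ℕ in atTop,
      (bondPercolation (torusGraph 3 n) (criticalProbI 3)).real
          {ω | ∃ x : TorusSite 3 n, a * (n : ℝ) ^ 3 ≤ ((openCluster ω x).ncard : ℝ)} ≤ 1 - ρ) :
    Summit.CriticalPhenomena.PercolationContinuityZ3.Theses.PercTorusSliceFilling.NoCriticalTorusGiant := by
  intro ε hε
  obtain ⟨ρ, hρ, hRa⟩ := hR
  rw [tendsto_order]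
  refine ⟨fun c hc => Eventually.of_forall fun n => hc.trans_le measureReal_nonneg, fun η hη => ?_⟩
  -- `q = (1 - ρ)₊ < 1`, and `j` with `q ^ (2^j) < η`
  set q : ℝ := max (1 - ρ) 0 with hq
  have hq0 : 0 ≤ q := le_max_right _ _
  have hq1 : q < 1 := max_lt (by linarith) one_pos
  obtain ⟨N, hN⟩ := exists_pow_lt_of_lt_one hη hq1
  obtain ⟨j, hj⟩ : ∃ j : ℕ, N ≤ 2 ^ j := ⟨N, Nat.lt_two_pow_self.le⟩
  have hqj : q ^ (2 ^ j) < η := (pow_le_pow_of_le_one hq0 hq1.le hj).trans_lt hN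
  -- the density `a = ε / (2 · 3^j)`
  set a : ℝ := ε / (2 * (3 : ℝ) ^ j) with ha
  have h3j : (0 : ℝ) < (3 : ℝ) ^ j := by positivity
  have ha0 : 0 < a := by positivity
  have hRn := hRa a ha0
  -- eventually `n ≥ 1` and `3^j ≤ ε n³ / 2`
  have hn1 : ∀ᶠ n : ℕ in atTop, 1 ≤ n := eventually_ge_atTop 1
  have hn2 : ∀ᶠ n : ℕ in atTop, (3 : ℝ) ^ j ≤ ε * (n : ℝ) ^ 3 / 2 := by
    have ht : Tendsto (fun n : ℕ => ε * (n : ℝ) ^ 3 / 2) atTop atTop := by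
      have := ((tendsto_pow_atTop (by norm_num : (3 : ℕ) ≠ 0)).comp
        tendsto_natCast_atTop_atTop).const_mul_atTop hε
      exact this.atTop_div_const (by norm_num : (0 : ℝ) < 2)
    exact ht.eventually_ge_atTop _
  filter_upwards [hRn, hn1, hn2] with n hRn' hn1' hn2'
  haveI : NeZero n := ⟨by omega⟩
  set μ := bondPercolation (torusGraph 3 n) (criticalProbI 3) with hμ
  set kn : ℕ := ⌈a * (n : ℝ) ^ 3⌉₊ with hkn
  have hn3 : (0 : ℝ) < (n : ℝ) ^ 3 := by positivity
  have han : 0 < a * (n : ℝ) ^ 3 := mul_pos ha0 hn3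
  have hkn1 : 1 ≤ kn := Nat.ceil_pos.mpr han
  have hkn_le : (kn : ℝ) ≤ a * (n : ℝ) ^ 3 + 1 := (Nat.ceil_lt_add_one han.le).le
  -- `3^j kn ≤ ε n³`
  have hbig : ((3 ^ j * kn : ℕ) : ℝ) ≤ ε * (n : ℝ) ^ 3 := by
    have h1 : ((3 ^ j * kn : ℕ) : ℝ) = (3 : ℝ) ^ j * kn := by push_cast; ring
    rw [h1]
    have h2 : (3 : ℝ) ^ j * (a * (n : ℝ) ^ 3) = ε * (n : ℝ) ^ 3 / 2 := by
      rw [ha]; field_simp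
    calc (3 : ℝ) ^ j * kn ≤ (3 : ℝ) ^ j * (a * (n : ℝ) ^ 3 + 1) :=
          mul_le_mul_of_nonneg_left hkn_le h3j.le
      _ = ε * (n : ℝ) ^ 3 / 2 + (3 : ℝ) ^ j := by rw [mul_add, h2, mul_one]
      _ ≤ ε * (n : ℝ) ^ 3 / 2 + ε * (n : ℝ) ^ 3 / 2 := by linarith
      _ = ε * (n : ℝ) ^ 3 := by ring
  -- event inclusions
  have hsub1 : {ω : BondConfig (TorusSite 3 n) |
      ∃ x : TorusSite 3 n, ε * (n : ℝ) ^ 3 ≤ ((openCluster ω x).ncard : ℝ)} ⊆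
        {ω | ∃ x : TorusSite 3 n, 3 ^ j * kn ≤ (openCluster ω x).ncard} := by
    rintro ω ⟨x, hx⟩
    refine ⟨x, ?_⟩
    exact_mod_cast hbig.trans hx
  have hsub2 : {ω : BondConfig (TorusSite 3 n) | ∃ x : TorusSite 3 n, kn ≤ (openCluster ω x).ncard} ⊆
      {ω | ∃ x : TorusSite 3 n, a * (n : ℝ) ^ 3 ≤ ((openCluster ω x).ncard : ℝ)} := by
    rintro ω ⟨x, hx⟩
    exact ⟨x, Nat.ceil_le.1 hx⟩
  have hRq : μ.real {ω | ∃ x : TorusSite 3 n, kn ≤ (openCluster ω x).ncard} ≤ q :=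
    ((measureReal_mono hsub2).trans hRn').trans (le_max_left _ _)
  calc μ.real {ω | ∃ x : TorusSite 3 n, ε * (n : ℝ) ^ 3 ≤ ((openCluster ω x).ncard : ℝ)}
      ≤ μ.real {ω | ∃ x : TorusSite 3 n, 3 ^ j * kn ≤ (openCluster ω x).ncard} :=
        measureReal_mono hsub1
    _ ≤ (μ.real {ω | ∃ x : TorusSite 3 n, kn ≤ (openCluster ω x).ncard}) ^ (2 ^ j) :=
        real_exists_pow_mul_le_pow (criticalProbI 3) n kn hkn1 j
    _ ≤ q ^ (2 ^ j) := pow_le_pow_left₀ measureReal_nonneg hRq _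
    _ < η := hqj

/-- **Crux ⇔ "no giant with probability bounded below"** (the universal-tightness reformulation of
the critical-torus problem, Easo–Hutchcroft 2024 §5 / Hutchcroft 2021 Thm 2.2 in qualitative form):
`NoCriticalTorusGiant ↔ ∃ ρ > 0, ∀ a > 0, ∀ᶠ n, P_{T_n,p_c}(∃ x, |C(x)| ≥ a n³) ≤ 1 - ρ`.  The residual
stub R of line `registered` is therefore EXACTLY as strong as the crux. [folklore] -/
theorem noCriticalTorusGiant_iff_noGiantWithPositiveProbability : Summit.CriticalPhenomena.PercolationContinuityZ3.Theses.PercTorusSliceFilling.NoCriticalTorusGiant ↔ ∃ ρ : ℝ, 0 < ρ ∧ ∀ a : ℝ, 0 < a → ∀ᶠ n : ℕ in atTop, (bondPercolation (torusGraph 3 n) (criticalProbI 3)).real {ω | ∃ x : TorusSite 3 n, a * (n : ℝ) ^ 3 ≤ ((openCluster ω x).ncard : ℝ)} ≤ 1 - ρ :=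
  ⟨noGiantWithPositiveProbability_of_noCriticalTorusGiant, noCriticalTorusGiant_of_noGiantWithPositiveProbability⟩

end Summit.CriticalPhenomena.PercolationContinuityZ3.Theorems.PercTorusSliceFillingNoCriticalTorusGiant

end
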